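import Summits.HodgeConjecture.HodgeConjecture.Theorems.HeckePrymWeilSummitOffWeilSectorLefschetzBBelowMiddle
import Summits.HodgeConjecture.HodgeConjecture.Theorems.HeckePrymWeilSummitOffWeilSectorCupProductAlgebraicDivisor
import HarnessLib

/-!
# Route HeckePrymWeil — `SummitOffWeilSector` (stmt-HodgeConjecture-14374), line `motivated-anchor-split`: conjecture `B` holds in every degree `a ≤ dim X` for every smooth projective complex variety, unconditionally

Companion of `…LefschetzBBelowMiddle` (p140910: `B(X)` below the middle degree GRANTED the
multiplicativity `Voisin2003_cupProduct_algebraicClasses`) and of the landed Stub 4a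
`stub_cupProductAlgebraicDivisor` (p142851: `Nᵃ H²ᵃ ∪ N¹ H² ⊆ Nᵃ⁺¹` on every smooth projective
complex variety, unconditionally — the divisor moves, `SupportedClassesPrimeDivisorLocal`). Since the
only products the below-middle degrees need are the powers `ηʲ⁺¹ = ηʲ ∪ η` of the polarisation class
`η ∈ N¹ H²`, the hypothesis disappears:

* `lefschetzPowTo_one_mem_algebraicClasses_holds` — `ηʲ ∈ Nʲ H²ʲ(X(ℂ); ℂ)` for every `η ∈ N¹ H²` on a
  smooth projective `X` (unconditional);
* `standardConjectureBStar_of_le_middle_holds` — **Grothendieck's standard conjecture of Lefschetz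
  type in André's `*_L`-form holds in every degree `a ≤ dim X`, for EVERY smooth projective complex
  variety `X` and every polarisation class** (`*_L = Lʲ = (· ∪ ηʲ) = [Δ_* ηʲ]^*`), unconditionally;
* `standardConjectureBStar_iff_aboveMiddle` — hence for smooth projective `Z`,
  `StandardConjectureBStar d Z η` is EQUIVALENT to its instances in the degrees `d < a < 2d` (the
  inverse Lefschetz isomorphisms `(L^{a-d})⁻¹ : Hᵃ → H^{2d-a}`, `0 < 2d - a < d` — Kleiman's
  "`θⁱ` algebraic for `0 < i < d`"; the degree `a = 2d` is c1's `standardConjectureBStar_of_eq_top`);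
* `standardConjectureBStar_of_aboveMiddle_holds` / `stub_lefschetzStandardB_of_aboveMiddle_holds` —
  the line's former Stub 1 (B for all varieties, all degrees) from its open core ALONE (registered
  sub-goal; supersedes `stub_lefschetzStandardB_of_aboveMiddle`, which also assumed Stub 4).

No definition and no named fact is introduced.

## References

* [Grothendieck1968] A. Grothendieck, Standard conjectures on algebraic cycles, Bombay 1968, §3 p. 196.
* [Kleiman1968] S. Kleiman, Algebraic cycles and the Weil conjectures, Dix exposés (1968), §2 Prop. 2.3.
* [Andre1996Motifs] Y. André, Pour une théorie inconditionnelle des motifs, Publ. Math. IHÉS 83 (1996), §0.2 (p. 7), §1.1 (p. 10), §3.2 Remarque (p. 21).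
* [VoisinHodgeII2003] C. Voisin, Hodge Theory and Complex Algebraic Geometry II, CUP 2003, §9.2.4 Prop. 9.20.
* [HatcherAT2002] A. Hatcher, Algebraic Topology, CUP 2002, §3.2 Thm. 3.11.
-/

noncomputable section

-- every declaration of this problem lives in `Summit.HodgeConjecture.HodgeConjecture.…` (summit = sub-problem)
set_option linter.dupNamespace false

open CategoryTheory AlgebraicGeometry MonoidalCategory CartesianMonoidalCategory
open Literature.AlgebraicGeometry.Motives Literature.AlgebraicGeometry.HodgeTheory
open Literature.AlgebraicTopology.SingularHomology Literature.Geometry.Kaehler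

namespace Summit.HodgeConjecture.HodgeConjecture.Theorems

variable {n : ℕ} {X : SchemeOver ℂ}

/-- **Powers of a divisor-supported class are algebraic, unconditionally**: for `X` smooth projective
over `ℂ` and `η ∈ N¹ H²(X(ℂ); ℂ)`, `ηʲ = Lʲ 1 ∈ Nʲ H²ʲ(X(ℂ); ℂ)` for every `j`: `η⁰ = 1 ∈ N⁰ = H⁰` and
`ηʲ⁺¹ = η ∪ ηʲ = ηʲ ∪ η` (even degrees, Hatcher Thm. 3.11) `∈ Nʲ ∪ N¹ ⊆ Nʲ⁺¹` by the landed divisor case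
of Voisin II Prop. 9.20 (`stub_cupProductAlgebraicDivisor`, p142851).
[cite: VoisinHodgeII2003, §9.2.4 Prop. 9.20] [cite: HatcherAT2002, §3.2 Thm. 3.11] -/
theorem lefschetzPowTo_one_mem_algebraicClasses_holds (hX : IsSmoothProjective n X)
    {η : complexBetti X 2} (hη : η ∈ algebraicClasses X 1) :
    ∀ (j : ℕ) (hm : 0 + 2 * j = 2 * j),
      lefschetzPowTo η j 0 (2 * j) hm (singularCohomology.one ℂ (ComplexPoints X)) ∈
        algebraicClasses X j
  | 0, hm => by
    have h1 : lefschetzPowTo η 0 0 (2 * 0) hm (singularCohomology.one ℂ (ComplexPoints X)) =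
        singularCohomology.one ℂ (ComplexPoints X) := rfl
    rw [h1, algebraicClasses_zero]
    exact Submodule.mem_top
  | j + 1, hm => by
    rw [lefschetzPowTo_succ_apply η j 0 (2 * j) (2 * (j + 1)) (by omega) hm (by omega),
      lefschetzOperator_apply]
    have ih := lefschetzPowTo_one_mem_algebraicClasses_holds hX hη j (by omega)
    rw [cupProduct_gradedComm_holds ℂ _ (show 2 + 2 * j = 2 * (j + 1) by omega)
      (show 2 * j + 2 = 2 * (j + 1) by omega) η _,
      show ((-1 : ℂ) ^ (2 * (2 * j))) = 1 by rw [pow_mul, neg_one_sq, one_pow], one_smul]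
    exact (cupProduct_mem_supportedClasses_congr (two_mul_add_two_mul j 1) _ rfl _ η).1
      (stub_cupProductAlgebraicDivisor hX ih hη)

/-- **Conjecture `B(X)` holds in every degree `a ≤ dim X`, for every smooth projective complex variety
`X` and every polarisation class `η` — unconditionally.** For `a + b = 2n` with `a ≤ n` (`b = a + 2j`,
`a + j = n`) André's Lefschetz involution `*_L : Hᵃ(X(ℂ); ℂ) → Hᵇ(X(ℂ); ℂ)` is `Lʲ`
(`lefschetzInvolution_apply_of_le`), i.e. `x ↦ ηʲ ∪ x = x ∪ ηʲ` (`lefschetzPow_apply_eq_cupProduct_pow`,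
graded commutativity), the algebraic correspondence `[Δ_* ηʲ]^*`
(`isAlgebraicCorrespondence_cupProduct_right`, p138014) since `ηʲ ∈ Nʲ H²ʲ`
(`lefschetzPowTo_one_mem_algebraicClasses_holds`). So of Grothendieck's `B(X)` in the `*_L`-form only
the INVERSE Lefschetz isomorphisms (degrees `a > dim X`) remain conjectural.
[cite: Grothendieck1968, §3 p. 196 (B(X))] [cite: Andre1996Motifs, §0.2 (p. 7), §1.1 (p. 10) and §3.2 Remarque (p. 21)]
[cite: HatcherAT2002, §3.2 Thm. 3.11] -/
theorem standardConjectureBStar_of_le_middle_holds (hX : IsSmoothProjective n X)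
    {η : complexBetti X 2} (hη : IsPolarizationClass n X η) {a b : ℕ} (hab : a + b = 2 * n)
    (ha : a ≤ n) : IsAlgebraicCorrespondence n n X X (lefschetzInvolution hη.hasHardLefschetz hab) := by
  obtain ⟨j, hj⟩ : ∃ j, a + j = n := ⟨n - a, by omega⟩
  obtain rfl : b = a + 2 * j := by omega
  have hηj := lefschetzPowTo_one_mem_algebraicClasses_holds hX hη.mem_algebraicClasses j (by omega)
  have heq : lefschetzInvolution hη.hasHardLefschetz hab =
      (cupProduct (rfl : a + 2 * j = a + 2 * j)).flip
        (lefschetzPowTo η j 0 (2 * j) (by omega) (singularCohomology.one ℂ (ComplexPoints X))) := by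
    refine LinearMap.ext fun c ↦ ?_
    rw [lefschetzInvolution_apply_of_le hη.hasHardLefschetz hj hab c, LinearMap.flip_apply,
      lefschetzPow_apply_eq_cupProduct_pow η j a (by omega) (by omega) c,
      cupProduct_gradedComm_holds ℂ _ (show 2 * j + a = a + 2 * j by omega) rfl _ c]
    rw [show ((-1 : ℂ) ^ (2 * j * a)) = 1 by rw [mul_assoc, pow_mul, neg_one_sq, one_pow], one_smul]
  rw [heq]
  exact isAlgebraicCorrespondence_cupProduct_right hX rfl (by omega) hηj

/-- **Conjecture `B` for all smooth projective complex varieties from its instances ABOVE the middle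
degree ALONE** (unconditional form of `standardConjectureBStar_of_aboveMiddle`): if for every smooth
projective `Z` of dimension `d`, every polarisation class `η` and every degree `d < a < 2d` the
Lefschetz involution `*_L : Hᵃ(Z(ℂ); ℂ) → H^{2d-a}(Z(ℂ); ℂ)` — the inverse of the hard-Lefschetz
isomorphism `L^{a-d}` — is induced by an algebraic correspondence, then `StandardConjectureBStar d Z η`
holds in full: degrees `a ≤ d` by `standardConjectureBStar_of_le_middle_holds`, degree `a = 2d` by
`standardConjectureBStar_of_eq_top`. [cite: Grothendieck1968, §3 p. 196 (B(X))]
[cite: Kleiman1968, §2 Prop. 2.3] [cite: Andre1996Motifs, §3.2 Remarque (p. 21)] -/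
theorem standardConjectureBStar_of_aboveMiddle_holds
    (hBup : ∀ ⦃d : ℕ⦄ ⦃Z : SchemeOver ℂ⦄ ⦃η : complexBetti Z 2⦄ (hZ : IsSmoothProjective d Z)
      (hη : IsPolarizationClass d Z η) ⦃a b : ℕ⦄ (hab : a + b = 2 * d), d < a → a < 2 * d →
        IsAlgebraicCorrespondence d d Z Z (lefschetzInvolution hη.hasHardLefschetz hab)) :
    ∀ (d : ℕ) (Z : SchemeOver ℂ) (η : complexBetti Z 2), IsSmoothProjective d Z →
      StandardConjectureBStar d Z η := by
  intro d Z η hZ hη a b hab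
  rcases le_or_gt a d with ha | ha
  · exact standardConjectureBStar_of_le_middle_holds hZ hη hab ha
  rcases lt_or_ge a (2 * d) with h2 | h2
  · exact hBup hZ hη hab ha h2
  · exact standardConjectureBStar_of_eq_top hZ hη hab (by omega)

/-- **For a smooth projective complex variety, conjecture `B` in André's `*_L`-form is EQUIVALENT to
the algebraicity of the inverse Lefschetz isomorphisms** (the degrees `d < a < 2d` of
`StandardConjectureBStar`): the forward direction is specialisation, the converse is
`standardConjectureBStar_of_le_middle_holds` (`a ≤ d`) and `standardConjectureBStar_of_eq_top`
(`a = 2d`). This is Kleiman's formulation "`B(X)` ⟺ the `θⁱ = (L^{d-i})⁻¹ : H^{2d-i} → Hⁱ` are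
algebraic for `0 < i < d`" on the tree's real carriers. [cite: Kleiman1968, §2 Prop. 2.3]
[cite: Grothendieck1968, §3 p. 196 (B(X))] -/
theorem standardConjectureBStar_iff_aboveMiddle {d : ℕ} {Z : SchemeOver ℂ} (hZ : IsSmoothProjective d Z)
    (η : complexBetti Z 2) :
    StandardConjectureBStar d Z η ↔
      ∀ (hη : IsPolarizationClass d Z η) (a b : ℕ) (hab : a + b = 2 * d), d < a → a < 2 * d →
        IsAlgebraicCorrespondence d d Z Z (lefschetzInvolution hη.hasHardLefschetz hab) := by
  refine ⟨fun h hη a b hab _ _ ↦ h hη a b hab, fun h hη a b hab ↦ ?_⟩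
  rcases le_or_gt a d with ha | ha
  · exact standardConjectureBStar_of_le_middle_holds hZ hη hab ha
  rcases lt_or_ge a (2 * d) with h2 | h2
  · exact h hη a b hab ha h2
  · exact standardConjectureBStar_of_eq_top hZ hη hab (by omega)

/-- **Registered sub-goal `stub_lefschetzStandardB_of_aboveMiddle_holds` of stmt-HodgeConjecture-14374**
(implication form of `standardConjectureBStar_of_aboveMiddle_holds`): the line's former Stub 1 —
conjecture `B` for every smooth projective complex variety in every degree — follows from the
algebraicity of the Lefschetz involutions in the degrees `d < a < 2d` alone.
[cite: Grothendieck1968, §3 p. 196 (B(X))] [cite: Kleiman1968, §2 Prop. 2.3] -/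
theorem stub_lefschetzStandardB_of_aboveMiddle_holds :
    (∀ ⦃d : ℕ⦄ ⦃Z : SchemeOver ℂ⦄ ⦃η : complexBetti Z 2⦄ (hZ : IsSmoothProjective d Z)
      (hη : IsPolarizationClass d Z η) ⦃a b : ℕ⦄ (hab : a + b = 2 * d), d < a → a < 2 * d →
        IsAlgebraicCorrespondence d d Z Z (lefschetzInvolution hη.hasHardLefschetz hab)) →
    ∀ (d : ℕ) (Z : SchemeOver ℂ) (η : complexBetti Z 2), IsSmoothProjective d Z →
      StandardConjectureBStar d Z η :=
  standardConjectureBStar_of_aboveMiddle_holds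

end Summit.HodgeConjecture.HodgeConjecture.Theorems

end
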